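import Mathlib.NumberTheory.ArithmeticFunction.Misc
import Mathlib.NumberTheory.Harmonic.EulerMascheroni
import Literature.NumberTheory.LFunctions.ColossallyAbundantProofs
import Literature.NumberTheory.LFunctions.RobinBriggsRange
import HarnessLib

/-!
# Superabundant numbers; the least counterexample to Robin's inequality is superabundant

Topic: `Literature/NumberTheory/LFunctions`. Companion of `RobinCriterion.lean` (Robin's inequality
`robinInequality n : σ(n) < e^γ n log log n`) and of the colossally abundant files
(`ColossallyAbundant*.lean`).

## Contents

* `Nat.Superabundant n` — the definition of Alaoglu–Erdős 1944, §2 (as restated by Akbary–Friggstad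
  2009, p. 273): `n ≥ 1` is *superabundant* if `σ(m)/m < σ(n)/n` for every `1 ≤ m < n`; with the
  unfolding lemma and the first values `1, 2` superabundant, `3` not (`Nat.superabundant_one`,
  `Nat.superabundant_two`, `Nat.not_superabundant_three`; OEIS A004394 starts `1, 2, 4, 6, 12, …`).
* **Akbary–Friggstad 2009, Theorem 3** (`Literature.NumberTheory.LFunctions.superabundant_of_least_not_robinInequality`,
  packaged as `….AkbaryFriggstad2009_thm3` over `IsLeast`): if Robin's inequality has a counterexample
  `n > 5040`, the least such counterexample is a superabundant number. Consequences proved here: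
  a counterexample `> 5040` exists iff a superabundant counterexample `> 5040` exists
  (`exists_superabundant_not_robinInequality_iff`), and Robin's criterion restricted to superabundant
  numbers (`robin_iff.superabundant`: from the named fact `robin_iff`, discharged in
  `RHClassicalEquivalentsRobinProofs.lean`, RH ⟺ Robin's inequality at every superabundant `n > 5040`)
  — the printed remark "one can attempt to disprove the Riemann Hypothesis computationally by testing
  (2) for superabundant numbers" (Akbary–Friggstad 2009, p. 274).

## The printed proof and the one deviation

Akbary–Friggstad (p. 274): (α) there is no counterexample with `5040 < n ≤ 10080`; (β) `10080` is
superabundant; so a least counterexample `n` has `n > 10080`, and if `n` were not superabundant there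
would be `k < n` with `σ(k)/k ≥ σ(n)/n`, w.l.o.g. `k ≥ 10080` by (β); then
`σ(k)/k ≥ σ(n)/n ≥ e^γ log log n > e^γ log log k`, so `k > 5040` is a smaller counterexample —
contradiction. Here (α)+(β) are replaced by the tree's kernel-certified range
`robinInequality_le_ten_pow_1958000` (`RobinBriggsRange.lean`): a counterexample `n ≥ 5041` has
`n > 10^1958000`, hence `log n > 3.9·10⁶` and `e^γ log log n > 1 + log 5040 ≥ 1 + log k ≥ σ(k)/k`
for every `k ≤ 5040` (`Nat.sigma_one_div_self_le_one_add_log`), which disposes of the small `k`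
without the superabundance of `10080`; the case `5041 ≤ k < n` is the printed monotonicity argument
verbatim. No numerics beyond `exp 1 < 2.7182818286` (Mathlib) and `log 10 > 2.3025850925` (`RobinAnalytic.log_ten_gt`) enter.

## Sources

* A. Akbary, Z. Friggstad, *Superabundant numbers and the Riemann hypothesis*, Amer. Math. Monthly
  116 (2009), 273–275: definition p. 273, Theorem 3 and its proof p. 274. [AkbaryFriggstad2009]
* L. Alaoglu, P. Erdős, *On highly composite and similar numbers*, Trans. AMS 56 (1944), 448–469,
  §2 (superabundant numbers). [AlaogluErdos1944]
* G. Robin, J. Math. Pures Appl. 63 (1984), 187–213, Thm. 1. [Robin1984]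

## Not here

No enumeration of superabundant numbers (there is no complete algorithm in print — Briggs 2006, §3;
Akbary–Friggstad p. 274) and no structure theory (Alaoglu–Erdős 1944, Thms. 1–9); the colossally
abundant reduction of Robin 1984, §3 Prop. 1 is `Robin1984_prop1_holds` (`ColossallyAbundantStructure.lean`).
-/

noncomputable section

open Real
open scoped ArithmeticFunction.sigma

namespace Nat

/-- `n` is **superabundant** (Alaoglu–Erdős 1944, §2; Akbary–Friggstad 2009, p. 273: "a positive
integer `n` is said to be superabundant if `σ(m)/m < σ(n)/n` for all `m < n`"): `n ≥ 1` and
`σ(m)/m < σ(n)/n` for every `1 ≤ m < n`, where `σ = ArithmeticFunction.sigma 1`. The first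
superabundant numbers are `1, 2, 4, 6, 12, 24, 36, 48, 60, 120, …` (OEIS A004394). Deliberate
extension of the `Nat` namespace, next to `Nat.ColossallyAbundant`.
[cite: AkbaryFriggstad2009, p. 273 (definition; from AlaogluErdos1944 §2)] -/
def Superabundant (n : ℕ) : Prop :=
  1 ≤ n ∧ ∀ m : ℕ, 1 ≤ m → m < n → (σ 1 m : ℝ) / m < (σ 1 n : ℝ) / n

/-- Unfolding `Nat.Superabundant` (definitional). [cite: AkbaryFriggstad2009, p. 273] -/
theorem superabundant_iff (n : ℕ) : Superabundant n ↔
    1 ≤ n ∧ ∀ m : ℕ, 1 ≤ m → m < n → (σ 1 m : ℝ) / m < (σ 1 n : ℝ) / n :=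
  Iff.rfl

/-- A superabundant number is `≥ 1`. [cite: AkbaryFriggstad2009, p. 273] -/
theorem Superabundant.one_le {n : ℕ} (h : Superabundant n) : 1 ≤ n := h.1

/-- The defining inequality of a superabundant number. [cite: AkbaryFriggstad2009, p. 273] -/
theorem Superabundant.lt {n m : ℕ} (h : Superabundant n) (hm : 1 ≤ m) (hmn : m < n) :
    (σ 1 m : ℝ) / m < (σ 1 n : ℝ) / n :=
  h.2 m hm hmn

/-- `1` is superabundant (vacuously; the printed list starts `1, 2, 4, 6, 12, …`).
[cite: AkbaryFriggstad2009, p. 273] -/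
theorem superabundant_one : Superabundant 1 :=
  ⟨le_rfl, fun _ hm hm1 => absurd hm1 (not_lt.2 hm)⟩

/-- `2` is superabundant: `σ(1)/1 = 1 < 3/2 = σ(2)/2`. [cite: AkbaryFriggstad2009, p. 273] -/
theorem superabundant_two : Superabundant 2 := by
  refine ⟨by norm_num, fun m hm hm2 => ?_⟩
  obtain rfl : m = 1 := by omega
  have h1 : σ 1 1 = 1 := by decide
  have h2 : σ 1 2 = 3 := by decide
  rw [h1, h2]
  norm_num

/-- `3` is not superabundant: `σ(2)/2 = 3/2 > 4/3 = σ(3)/3`. [cite: AkbaryFriggstad2009, p. 273] -/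
theorem not_superabundant_three : ¬ Superabundant 3 := by
  intro h
  have h23 := h.lt (m := 2) (by norm_num) (by norm_num)
  have h2 : σ 1 2 = 3 := by decide
  have h3 : σ 1 3 = 4 := by decide
  rw [h2, h3] at h23
  norm_num at h23

end Nat

namespace Literature.NumberTheory.LFunctions

/-! ### Auxiliary bounds -/

/-- A counterexample `n ≥ 5041` to Robin's inequality exceeds `10^1958000` (contrapositive of the
kernel-certified range `robinInequality_le_ten_pow_1958000`).
[cite: Axler2017, §2 (the range, from Briggs2006 §4 and Robin1984 §3 Prop. 1)] -/
theorem ten_pow_lt_of_not_robinInequality {n : ℕ} (hn : 5041 ≤ n) (h : ¬ robinInequality n) :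
    10 ^ 1958000 < n := by
  by_contra hle
  exact h (robinInequality_le_ten_pow_1958000 n hn (not_lt.1 hle))

/-- For a counterexample `n ≥ 5041` to Robin's inequality, `log n > 3 916 000` (since `n > 10^1958000`
and `log 10 > 2.30258`, `RobinAnalytic.log_ten_gt`). [cite: Axler2017, §2] -/
theorem log_gt_of_not_robinInequality {n : ℕ} (hn : 5041 ≤ n) (h : ¬ robinInequality n) :
    (3916000 : ℝ) < Real.log n := by
  have hlt := ten_pow_lt_of_not_robinInequality hn h
  have hpow_pos : (0 : ℝ) < (10 : ℝ) ^ 1958000 := pow_pos (by norm_num) _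
  have hcast : (10 : ℝ) ^ 1958000 < (n : ℝ) := by
    have := Nat.cast_lt (α := ℝ) |>.2 hlt
    rwa [Nat.cast_pow, Nat.cast_ofNat] at this
  have hlog : Real.log ((10 : ℝ) ^ 1958000) < Real.log n :=
    Real.log_lt_log hpow_pos hcast
  rw [Real.log_pow] at hlog
  have h10 := RobinAnalytic.log_ten_gt
  push_cast at hlog
  nlinarith

/-- For every `1 ≤ k ≤ 5040` and every counterexample `n ≥ 5041` to Robin's inequality,
`σ(k)/k < e^γ log log n`: indeed `σ(k)/k ≤ 1 + log k` (`Nat.sigma_one_div_self_le_one_add_log`),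
`exp (1 + log k) = e·k < 3·5040 < log n`, and `e^γ ≥ 1`. This replaces steps (α)–(β) of the printed
proof (Akbary–Friggstad 2009, p. 274) by the tree's certified range. [cite: AkbaryFriggstad2009, Thm. 3 (proof)] -/
theorem sigma_div_lt_of_le_5040_of_not_robinInequality {k n : ℕ} (hk : 1 ≤ k) (hk' : k ≤ 5040)
    (hn : 5041 ≤ n) (h : ¬ robinInequality n) :
    (σ 1 k : ℝ) / k < Real.exp eulerMascheroniConstant * Real.log (Real.log n) := by
  have hlogn := log_gt_of_not_robinInequality hn h
  have hlogn_pos : 0 < Real.log n := by linarith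
  have hk0 : (0 : ℝ) < k := by exact_mod_cast hk
  have hkle : (k : ℝ) ≤ 5040 := by exact_mod_cast hk'
  -- `1 + log k < log (log n)` since `exp (1 + log k) = e · k < log n`.
  have hstep : 1 + Real.log k < Real.log (Real.log n) := by
    rw [Real.lt_log_iff_exp_lt hlogn_pos, Real.exp_add, Real.exp_log hk0]
    have h1 := Real.exp_one_lt_d9
    nlinarith
  have hσ : (σ 1 k : ℝ) / k ≤ 1 + Real.log k :=
    Nat.sigma_one_div_self_le_one_add_log (by omega)
  have hll_pos : 0 < Real.log (Real.log n) := by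
    have : 0 ≤ Real.log k := Real.log_nonneg (by exact_mod_cast hk)
    linarith
  have hγ : 1 ≤ Real.exp eulerMascheroniConstant :=
    Real.one_le_exp (le_of_lt (lt_trans (by norm_num) Real.one_half_lt_eulerMascheroniConstant))
  calc (σ 1 k : ℝ) / k ≤ 1 + Real.log k := hσ
    _ < Real.log (Real.log n) := hstep
    _ ≤ Real.exp eulerMascheroniConstant * Real.log (Real.log n) :=
        le_mul_of_one_le_left hll_pos.le hγ

/-! ### Akbary–Friggstad 2009, Theorem 3 -/

/-- **Akbary–Friggstad 2009, Theorem 3** (hypothesis form): if `n ≥ 5041` violates Robin's inequality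
and every `5041 ≤ m < n` satisfies it, then `n` is superabundant. Proof as printed (p. 274) for
`5041 ≤ m < n` — `σ(m)/m < e^γ log log m ≤ e^γ log log n ≤ σ(n)/n` — and by
`sigma_div_lt_of_le_5040_of_not_robinInequality` for `m ≤ 5040`.
[cite: AkbaryFriggstad2009, Thm. 3] -/
theorem superabundant_of_least_not_robinInequality {n : ℕ} (hn : 5041 ≤ n)
    (hfail : ¬ robinInequality n) (hmin : ∀ m : ℕ, 5041 ≤ m → m < n → robinInequality m) :
    Nat.Superabundant n := by
  have hn0 : (0 : ℝ) < n := by exact_mod_cast (show 0 < n by omega)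
  -- `σ(n)/n ≥ e^γ log log n` from the failure of Robin's inequality.
  have hfail' : Real.exp eulerMascheroniConstant * Real.log (Real.log n) ≤ (σ 1 n : ℝ) / n := by
    have h1 : ¬ (σ 1 n : ℝ) < Real.exp eulerMascheroniConstant * n * Real.log (Real.log n) := hfail
    rw [not_lt] at h1
    rw [le_div_iff₀ hn0]
    calc Real.exp eulerMascheroniConstant * Real.log (Real.log n) * n
        = Real.exp eulerMascheroniConstant * n * Real.log (Real.log n) := by ring
      _ ≤ (σ 1 n : ℝ) := h1
  refine ⟨by omega, fun m hm hmn => ?_⟩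
  by_cases hm' : m ≤ 5040
  · exact lt_of_lt_of_le (sigma_div_lt_of_le_5040_of_not_robinInequality hm hm' hn hfail) hfail'
  · have hm5041 : 5041 ≤ m := by omega
    have hRI : (σ 1 m : ℝ) < Real.exp eulerMascheroniConstant * m * Real.log (Real.log m) :=
      hmin m hm5041 hmn
    have hm0 : (0 : ℝ) < m := by exact_mod_cast (show 0 < m by omega)
    have hRI' : (σ 1 m : ℝ) / m < Real.exp eulerMascheroniConstant * Real.log (Real.log m) := by
      rw [div_lt_iff₀ hm0]
      calc (σ 1 m : ℝ) < Real.exp eulerMascheroniConstant * m * Real.log (Real.log m) := hRI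
        _ = Real.exp eulerMascheroniConstant * Real.log (Real.log m) * m := by ring
    -- monotonicity of `log log` on `[e, ∞)`: `5041 ≤ m < n`.
    have hme : (1 : ℝ) < Real.log m := by
      rw [Real.lt_log_iff_exp_lt hm0]
      have h1 := Real.exp_one_lt_d9
      have : (5041 : ℝ) ≤ m := by exact_mod_cast hm5041
      linarith
    have hlogm_pos : 0 < Real.log m := by linarith
    have hmn' : (m : ℝ) ≤ n := by exact_mod_cast hmn.le
    have hll : Real.log (Real.log m) ≤ Real.log (Real.log n) :=
      Real.log_le_log hlogm_pos (Real.log_le_log hm0 hmn')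
    have hγ : 0 < Real.exp eulerMascheroniConstant := Real.exp_pos _
    calc (σ 1 m : ℝ) / m < Real.exp eulerMascheroniConstant * Real.log (Real.log m) := hRI'
      _ ≤ Real.exp eulerMascheroniConstant * Real.log (Real.log n) :=
          mul_le_mul_of_nonneg_left hll hγ.le
      _ ≤ (σ 1 n : ℝ) / n := hfail'

/-- **Akbary–Friggstad 2009, Theorem 3** (as printed: "If there is any counterexample to Robin's
inequality (2), then the least such counterexample is a superabundant number"; (2) is Robin's
inequality for `n > 5040`): the least element of `{n | 5040 < n ∧ ¬ robinInequality n}` is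
superabundant. [cite: AkbaryFriggstad2009, Thm. 3] -/
theorem AkbaryFriggstad2009_thm3 {n : ℕ}
    (h : IsLeast {n : ℕ | 5040 < n ∧ ¬ robinInequality n} n) : Nat.Superabundant n := by
  obtain ⟨⟨hn, hfail⟩, hleast⟩ := h
  refine superabundant_of_least_not_robinInequality (by omega) hfail fun m hm hmn => ?_
  by_contra hm'
  have : n ≤ m := hleast ⟨by omega, hm'⟩
  omega

/-- If Robin's inequality fails at some `n > 5040`, it fails at some superabundant `n > 5040`
(the least counterexample; Akbary–Friggstad 2009, Thm. 3 and the remark following it, p. 274).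
[cite: AkbaryFriggstad2009, Thm. 3] -/
theorem exists_superabundant_not_robinInequality_iff :
    (∃ n : ℕ, 5040 < n ∧ ¬ robinInequality n) ↔
      ∃ n : ℕ, Nat.Superabundant n ∧ 5040 < n ∧ ¬ robinInequality n := by
  constructor
  · rintro ⟨n, hn, hfail⟩
    classical
    let S : Set ℕ := {n : ℕ | 5040 < n ∧ ¬ robinInequality n}
    have hS : S.Nonempty := ⟨n, hn, hfail⟩
    obtain ⟨m, hm, hleast⟩ : ∃ m ∈ S, ∀ k ∈ S, m ≤ k :=
      ⟨Nat.find hS, Nat.find_spec hS, fun k hk => Nat.find_min' hS hk⟩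
    exact ⟨m, AkbaryFriggstad2009_thm3 ⟨hm, fun k hk => hleast k hk⟩, hm.1, hm.2⟩
  · rintro ⟨n, -, hn, hfail⟩
    exact ⟨n, hn, hfail⟩

/-- **Robin's criterion on superabundant numbers** (Akbary–Friggstad 2009, p. 274: "As a consequence
of Theorem 3, one can attempt to disprove the Riemann Hypothesis computationally by testing (2) for
superabundant numbers"): from the named fact `robin_iff` (Robin 1984, Thm. 1 and §4 Prop. 1;
discharged as `robin_iff_holds` in `RHClassicalEquivalentsRobinProofs.lean`), RH holds iff Robin's
inequality holds at every superabundant `n > 5040`. [cite: AkbaryFriggstad2009, Thm. 3 and p. 274] -/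
theorem robin_iff.superabundant (h : robin_iff) :
    RiemannHypothesis ↔ ∀ n : ℕ, Nat.Superabundant n → 5040 < n → robinInequality n := by
  rw [robin_iff_iff.1 h]
  constructor
  · exact fun hall n _ hn => hall n hn
  · intro hSA n hn
    by_contra hfail
    obtain ⟨m, hmSA, hm, hmfail⟩ :=
      exists_superabundant_not_robinInequality_iff.1 ⟨n, hn, hfail⟩
    exact hmfail (hSA m hmSA hm)

end Literature.NumberTheory.LFunctions

end
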